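import Summits.BirchSwinnertonDyer.BirchSwinnertonDyer.Theorems.KimAtThreeStubOfLiftableAlgebra
import Summits.BirchSwinnertonDyer.Rank1Residual.GaloisImage.PropagatedStructure
import Summits.BirchSwinnertonDyer.Rank1Residual.GaloisImage.TorsionReductionOfLe
import Summits.BirchSwinnertonDyer.Rank1Residual.GaloisImage.KolyvaginScalarTransportLocal
import Literature.NumberTheory.EllipticCurves.KummerSelmerStructure
import HarnessLib

/-!
# Route `KimAtThreeKolyvagin` (rung W2), crux `StubAtEmptyLevelThree` (item 19561): the stub at the
# empty level FROM LIFTABILITY, in the tree's Galois-cohomology currency (Mazur–Rubin Thm. 4.4.3 at `n = 1`)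

Cell `bsd-addord`, seat `bsd-addord-w2-c2` (gen 3). TOOL FILE: one theorem, no definition, no named fact, no
`sorry`; closes nothing (its Galois-side inputs are DISPLAYED, to be discharged one by one in cell n1011's
currency); books nothing. HONEST FRAMING: BSD is not proved by any of this; item 19561 stays OPEN.

## What

`stubShape_of_liftable_three`: for `W/ℚ`, a level `m = k + 1` and a LIFT level `m̃ = k̃ + 1 ≥ m`, a
reduction map `red : E[3^{k̃}·3] → E[3^k·3]` (any continuous `Γ_ℚ`-map; in use: multiplication by
`3^{k̃−k}`, `GaloisImage.exists_torsionReduction_three`), a finite subgroup `S̃ ⊆ H¹(ℚ, E[3^{k̃+1}])` (in use: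
the propagated Selmer group of the lift) such that
* (i) on `S̃` the kernel of `red_* = galoisCohomology.map red 1` is the `3^{k̃−k}`-torsion and `3^{k̃+1}·S̃ = 0`
  (Mazur–Rubin Lemma 4.1.1 (i): `0 → E[3^{k̃−k}] → E[3^{k̃+1}] → E[3^{k+1}] → 0` with `E(ℚ̄)^{Γ}[3] = 0`),
* (iii) the three counts `#S̃ = 3^{k̃+1+n₀}`, `#S̃[3^{k̃−k}] = 3^{k̃−k+n₀}`, `#S̃[3^{k̃}] = 3^{k̃+n₀}` (Mazur–Rubin
  Thm. 4.1.13 with `χ = 1`: `#H¹_𝓕(ℚ, E[3^i]) = 3^i·#H¹_{𝓕*}` at `i = k̃−k, k̃, k̃+1`, the dual Selmer group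
  having the constant order `3^{n₀}` there — saturation, Lemma 4.1.1 (ii), valid once `n₀ < m ≤ k̃ − k + 1`),
* `red_*(S̃) ⊆ H¹_{𝓕_can}(ℚ, E[3^{k+1}])` (propagation is transitive),
and a class `x` which is (ii) LIFTABLE (`x ∈ red_*(S̃)` — for the bottom class `g(∅)` of the generator of
`KS(E[3^{k+1}], 𝓕_can)`: evaluation at a deep core vertex is bijective at both levels, [S24] Thm. 4.4 (1) +
`TorsionLevel.injective_eval_kolyvaginSystems_allDepths`) with (iv) `ord(x)·3^{n₀} = 3^{k+1}` ([S24] Thm. 4.4 (2),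
clause 1, VERBATIM the conclusion of `Sakamoto2024.kolyvaginSystems_idealOfBasis_eq_fittingIdeal_zmod_three_pow`
at `d = ∅`): THEN `x = 3^{n₀}•e + m'` with `e ∈ H¹_{𝓕_can}(ℚ, E[3^{k+1}])`, `m' ∈ H¹_𝓚` (here `m' = 0`) — the
conclusion of item 19561 `StubAtEmptyLevelThree` for `x = g(∅)`. The proof is the landed algebra
`KimAtThreeStubOfLiftable.exists_stubShape_of_liftable` (MR Thm. 4.4.3, Case 1) applied to
`φ = red_* ∘ (S̃ ↪ H¹)`; clause 2 of [S24] Thm. 4.4 (2) (`x = 0` when `3^{k+1} ∣ #H¹_{𝓕*}`) is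
`KimAtThreeStubOfLiftable.exists_stubShape_of_eq_zero`.

`stubShape_of_liftable_three_of_surj`: the same with (i) and the propagation inclusion DISCHARGED under
surj(3) from cell n1011's scalar-transport lemmas (`Transport.map_torsionInclusion_map_red`: `incl_* ∘ red_* =
3^{k̃−k}`; `Transport.map_torsionInclusion_injective` + `Transport.geomTorsion_eq_zero_of_fixed_of_surj`:
`incl_*` injective; `Transport.pow_succ_nsmul_galoisCohomology`; `Transport.map_red_mem_selmerGroup_atLevel` at
the empty level): what stays displayed is (ii) liftability, (iii) the three counts, (iv) the order.

References: [MazurRubin2004] Lemma 4.1.1, Thm. 4.1.13, Thm. 4.4.1, Thm. 4.4.3 (pp. 35–47; held text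
`HOME/lit/mazurrubin2004/txt-authors-pdf/p0041–p0053`); [Sakamoto2024] Thm. 4.4; [Rubin2011] Thm. 2.8.4.
-/

-- the Theorems namespace of a single-conjunct summit repeats the summit name by design (D-0017)
set_option linter.dupNamespace false

noncomputable section

open scoped Classical ContRepresentation
open Field WeierstrassCurve Literature.NumberTheory.EllipticCurves Literature.NumberTheory.GaloisRepresentations
  Literature.NumberTheory.GaloisRepresentations.DiscreteGaloisModule Literature.NumberTheory.GaloisCohomology
  Summit.BirchSwinnertonDyer.Rank1Residual.GaloisImage

namespace Summit.BirchSwinnertonDyer.BirchSwinnertonDyer.Theorems.KimAtThreeStubOfLiftable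

/-- **The stub at `∅` from liftability, tree currency** (module docstring): displayed inputs (i) kernel /
exponent on the lift's Selmer group `S̃`, (iii) three counts, the propagation inclusion `red_*(S̃) ⊆ H¹_{𝓕_can}`,
(ii) `x ∈ red_*(S̃)`, (iv) `ord(x)·3^{n₀} = 3^{k+1}`; conclusion: `x = 3^{n₀}•e + m'`, `e ∈ H¹_{𝓕_can}(ℚ, E[3^{k+1}])`,
`m' ∈ H¹_𝓚(ℚ, E[3^{k+1}])`. [cite: MazurRubin2004, Thm. 4.4.3 (pp. 46–47), Lemma 4.1.1 and Thm. 4.1.13 (pp. 35–39)]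
[cite: Sakamoto2024, Thm. 4.4 (2) (p. 926)] -/
theorem stubShape_of_liftable_three (W : WeierstrassCurve ℚ) [W.IsElliptic] (k kt : ℕ) (hkk : k ≤ kt)
    {n₀ : ℕ}
    (red : (W.torsionGaloisModule (((3 : ℕ) : ℤ) ^ kt * ((3 : ℕ) : ℤ))).toContRepresentation →ⁱL
      (W.torsionGaloisModule (((3 : ℕ) : ℤ) ^ k * ((3 : ℕ) : ℤ))).toContRepresentation)
    (Stil : AddSubgroup (galoisCohomology (W.torsionGaloisModule (((3 : ℕ) : ℤ) ^ kt * ((3 : ℕ) : ℤ))) 1))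
    [Finite Stil]
    -- (i) kernel of the reduction on `S̃` = the `3^{k̃-k}`-torsion; `3^{k̃+1}` kills `S̃`
    (hker : ∀ y : Stil, galoisCohomology.map red 1 (y : _) = 0 ↔ 3 ^ (kt - k) • y = 0)
    (hkill : ∀ y : Stil, 3 ^ (kt + 1) • y = 0)
    -- (iii) the three counts
    (hcard : Nat.card Stil = 3 ^ (kt + 1 + n₀))
    (hcardj : Nat.card {y : Stil // 3 ^ (kt - k) • y = 0} = 3 ^ (kt - k + n₀))
    (hcardtop : Nat.card {y : Stil // 3 ^ kt • y = 0} = 3 ^ (kt + n₀))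
    -- the reduction of the lift's Selmer group lies in the propagated Selmer group of `E[3^{k+1}]`
    (hmap : ∀ y : Stil, galoisCohomology.map red 1 (y : _) ∈ (propagatedSelmerStructure W 3 k).selmerGroup)
    -- (ii) liftability and (iv) the order of `x`
    {x : galoisCohomology (W.torsionGaloisModule (((3 : ℕ) : ℤ) ^ k * ((3 : ℕ) : ℤ))) 1}
    (hx : ∃ y : Stil, galoisCohomology.map red 1 (y : _) = x)
    (hord : addOrderOf x * 3 ^ n₀ = 3 ^ (k + 1)) :
    ∃ e ∈ (propagatedSelmerStructure W 3 k).selmerGroup,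
      ∃ m' ∈ (W.kummerSelmerStructure (((3 : ℕ) : ℤ) ^ k * ((3 : ℕ) : ℤ))).selmerGroup,
        x = 3 ^ n₀ • e + m' := by
  haveI : Fact (Nat.Prime 3) := ⟨Nat.prime_three⟩
  -- `φ = red_* ∘ (S̃ ↪ H¹)`
  let φ : Stil →+ galoisCohomology (W.torsionGaloisModule (((3 : ℕ) : ℤ) ^ k * ((3 : ℕ) : ℤ))) 1 :=
    (galoisCohomology.map red 1).comp Stil.subtype
  have hφ : ∀ y : Stil, φ y = galoisCohomology.map red 1 (y : _) := fun _ => rfl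
  -- exponents: `j = k̃ - k`, `m = k + 1`, `c = n₀`
  have e1 : kt - k + (k + 1) = kt + 1 := by omega
  have e2 : kt - k + (k + 1) - 1 = kt := by omega
  have hker' : ∀ y : Stil, φ y = 0 ↔ 3 ^ (kt - k) • y = 0 := fun y => by rw [hφ]; exact hker y
  have hM' : ∀ y : Stil, 3 ^ (kt - k + (k + 1)) • y = 0 := fun y => by rw [e1]; exact hkill y
  have hcard' : Nat.card Stil = 3 ^ (kt - k + (k + 1) + n₀) := by rw [e1]; exact hcard
  have hcardtop' : Nat.card {y : Stil // 3 ^ (kt - k + (k + 1) - 1) • y = 0} =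
      3 ^ (kt - k + (k + 1) - 1 + n₀) := by rw [e2]; exact hcardtop
  have hS : φ.range ≤ (propagatedSelmerStructure W 3 k).selmerGroup := by
    rintro _ ⟨y, rfl⟩
    exact hmap y
  have hx' : x ∈ φ.range := by
    obtain ⟨y, hy⟩ := hx
    exact ⟨y, hy⟩
  exact exists_stubShape_of_liftable φ (Nat.succ_le_succ (Nat.zero_le k)) hker' hM' hcard' hcardj hcardtop'
    _ _ hS hx' hord

/-- **The stub at `∅` from liftability with inputs (i) and the propagation inclusion DISCHARGED under
surj(3)** (cell n1011's scalar-transport lemmas: `Transport.map_torsionInclusion_map_red` — `incl_* ∘ red_*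
= 3^{k̃−k}` —, `Transport.map_torsionInclusion_injective` — `incl_*` injective as `E(ℚ̄)[3^{k̃+1}]^{Γ} = 0`
under surj(3), `Transport.geomTorsion_eq_zero_of_fixed_of_surj` —, `Transport.pow_succ_nsmul_galoisCohomology`,
and `Transport.map_red_mem_selmerGroup_atLevel` at the empty level). What stays DISPLAYED: the three counts
on `S̃ = H¹_{𝓕_can}(ℚ, E[3^{k̃+1}])` (MR Thm. 4.1.13 + dual saturation), the liftability of `x`
(`x ∈ red_*(S̃)`), and its order ([S24] Thm. 4.4 (2), clause 1). For the generator `g` of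
`KS(E[3^{k+1}], 𝓕_can)` and `x = g(∅)` the conclusion is that of item 19561.
[cite: MazurRubin2004, Thm. 4.4.3 (pp. 46–47) and Lemma 4.1.1 (p. 35)] [cite: Sakamoto2024, Thm. 4.4 (2) (p. 926)]
[cite: Rubin2011, §3.1 (p. 29)] -/
theorem stubShape_of_liftable_three_of_surj (W : WeierstrassCurve ℚ) [W.IsElliptic]
    (hsurj : W.HasSurjectiveModNGaloisRep ((3 : ℕ) : ℤ)) (k kt : ℕ) (hkk : k ≤ kt) {n₀ : ℕ}
    (red : (W.torsionGaloisModule (((3 : ℕ) : ℤ) ^ kt * ((3 : ℕ) : ℤ))).toContRepresentation →ⁱL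
      (W.torsionGaloisModule (((3 : ℕ) : ℤ) ^ k * ((3 : ℕ) : ℤ))).toContRepresentation)
    (hred : ∀ x : geomTorsion W (((3 : ℕ) : ℤ) ^ kt * ((3 : ℕ) : ℤ)),
      ((red x : geomTorsion W (((3 : ℕ) : ℤ) ^ k * ((3 : ℕ) : ℤ))) : geomPoints W) =
        (((3 : ℕ) : ℤ) ^ (kt - k)) • (x : geomPoints W))
    [Finite (propagatedSelmerStructure W 3 kt).selmerGroup]
    -- (iii) the three counts on `S̃ = H¹_{𝓕_can}(ℚ, E[3^{k̃+1}])`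
    (hcard : Nat.card (propagatedSelmerStructure W 3 kt).selmerGroup = 3 ^ (kt + 1 + n₀))
    (hcardj : Nat.card {y : (propagatedSelmerStructure W 3 kt).selmerGroup // 3 ^ (kt - k) • y = 0} =
      3 ^ (kt - k + n₀))
    (hcardtop : Nat.card {y : (propagatedSelmerStructure W 3 kt).selmerGroup // 3 ^ kt • y = 0} =
      3 ^ (kt + n₀))
    -- (ii) liftability and (iv) the order of `x`
    {x : galoisCohomology (W.torsionGaloisModule (((3 : ℕ) : ℤ) ^ k * ((3 : ℕ) : ℤ))) 1}
    (hx : ∃ y ∈ (propagatedSelmerStructure W 3 kt).selmerGroup, galoisCohomology.map red 1 y = x)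
    (hord : addOrderOf x * 3 ^ n₀ = 3 ^ (k + 1)) :
    ∃ e ∈ (propagatedSelmerStructure W 3 k).selmerGroup,
      ∃ m' ∈ (W.kummerSelmerStructure (((3 : ℕ) : ℤ) ^ k * ((3 : ℕ) : ℤ))).selmerGroup,
        x = 3 ^ n₀ • e + m' := by
  -- no `Γ_ℚ`-fixed point on `E[3^{k̃+1}]` (surj(3))
  have hΓ : ∀ P : geomTorsion W (((3 : ℕ) : ℤ) ^ kt * ((3 : ℕ) : ℤ)),
      (∀ σ : absoluteGaloisGroup ℚ, σ • P = P) → P = 0 :=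
    fun P hP => Transport.geomTorsion_eq_zero_of_fixed_of_surj W hsurj kt P hP
  have hinj := Transport.map_torsionInclusion_injective W hkk hΓ
  -- (i) kernel = `3^{k̃-k}`-torsion, via `incl_* ∘ red_* = 3^{k̃-k}` and injectivity of `incl_*`
  have hker : ∀ y : (propagatedSelmerStructure W 3 kt).selmerGroup, galoisCohomology.map red 1 y.1 = 0 ↔ 3 ^ (kt - k) • y = 0 := by
    intro y
    have hcomp := Transport.map_torsionInclusion_map_red W hkk red hred y.1
    constructor
    · intro h
      apply Subtype.ext
      rw [AddSubgroupClass.coe_nsmul, ZeroMemClass.coe_zero, ← hcomp, h, map_zero]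
    · intro h
      have h' : (3 ^ (kt - k)) • y.1 = 0 := by
        rw [← AddSubgroupClass.coe_nsmul, h, ZeroMemClass.coe_zero]
      apply hinj
      rw [hcomp, h', map_zero]
  have hkill : ∀ y : (propagatedSelmerStructure W 3 kt).selmerGroup, 3 ^ (kt + 1) • y = 0 :=
      fun y => Subtype.ext (by
    rw [AddSubgroupClass.coe_nsmul, ZeroMemClass.coe_zero]
    exact Transport.pow_succ_nsmul_galoisCohomology W kt _)
  -- the propagation inclusion `red_*(S̃) ⊆ H¹_{𝓕_can}(ℚ, E[3^{k+1}])` (empty level of trivial data)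
  let D : KolyvaginDatum (W.torsionGaloisModule (((3 : ℕ) : ℤ) ^ k * ((3 : ℕ) : ℤ))) :=
    ⟨∅, cyclotomicTransverse _, fun _ => 0⟩
  let D' : KolyvaginDatum (W.torsionGaloisModule (((3 : ℕ) : ℤ) ^ kt * ((3 : ℕ) : ℤ))) :=
    ⟨∅, cyclotomicTransverse _, fun _ => 0⟩
  have hmap : ∀ y : (propagatedSelmerStructure W 3 kt).selmerGroup, galoisCohomology.map red 1 y.1 ∈ (propagatedSelmerStructure W 3 k).selmerGroup := by
    intro y
    have hy : y.1 ∈ (D'.atLevel (propagatedSelmerStructure W 3 kt) ∅).selmerGroup := by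
      simp
    simpa using Transport.map_red_mem_selmerGroup_atLevel W hkk red hred D D' rfl rfl hy
  have hx' : ∃ y : (propagatedSelmerStructure W 3 kt).selmerGroup, galoisCohomology.map red 1 y.1 = x := by
    obtain ⟨y, hy, hyx⟩ := hx
    exact ⟨⟨y, hy⟩, hyx⟩
  exact stubShape_of_liftable_three W k kt hkk red _ hker hkill hcard hcardj hcardtop hmap hx' hord

end Summit.BirchSwinnertonDyer.BirchSwinnertonDyer.Theorems.KimAtThreeStubOfLiftable

end
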